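import Summits.BirchSwinnertonDyer.BirchSwinnertonDyer.Theorems.KimAtThreeShallowEqDeepGoodCoreVertexTransverse
import HarnessLib

/-!
# Route `KimAtThreeKolyvagin` (rung W2), crux `ShallowEqDeepAtTorsionFree` (stmt-BirchSwinnertonDyer-19077):
# `hord` — the good core vertex's generator has full order, modulo [S24] Thm. 4.4 (1) only

Cell `bsd-addord`, seat `bsd-addord-w2-c4` (D-0074 row B7), gen 3; seventh file of the GOOD CORE VERTEX
port (siblings `KimAtThreeShallowEqDeepGoodCoreVertex{,Rat,Devissage,Core,Order,Transverse}`).  TOOL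
theorems only (no definition, no named fact, no `sorry`); nothing asserted about any curve; nothing
booked; no crux proved.
* `lambdaStar_induced_atLevel_eq_zero_rat_three_deep`: at a level `d` of a datum `D₂` on `E[3^{j+1}·3]`
  with primes in Sakamoto's class of `τ` on `E[3^{j+1}·3]` (the route's deep class) and cyclotomic
  transverse conditions, the vanishing of the dual Selmer group of the residual Kummer structure
  `𝓚̄(d)` (files 1–2) gives **`λ^*(d) = 0` for `(𝓕_can^{(j+1)}(d)).induced [3^{j+1}]`** — the hypothesis
  of [S24] Thm. 4.4 (1)'s bijectivity clause at `d` in n1011's `SakamotoN11InstanceDeep` shape — with NO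
  local hypothesis left (file 5 §11 + file 6's onto lemma).
* `addOrderOf_apply_eq_rat_three_deep`: with [S24] Thm. 4.4 (1) at depth `j + 2` on `D₂` (freeness of
  `KS₁` + the bijectivity clause: the conclusion of n1011's
  `kolyvaginSystems_freeRankOne_propagatedSelmerStructure_deep` = the S24-DEEP port, or of the named fact
  on a same-level class), every generator `g` (`hgen`) has **`addOrderOf (g d) = 3^{j+2}`** — VERBATIM the
  `hord` of `KimAtThreeDeepUpperEndCore.EndCore.exists_certificate_of_witnessAt` at depth index `j + 1`.
STATE OF THE PORT after the seven files: for every depth `≥ 2`, above every level, a level `d` with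
`3^{#d} ∣ 3^{#n}·#H¹_{𝓚̄(n)^*}` (`∣ #Sel₃(E/ℚ)` from `∅`), `hinj` (file 3
`exists_goodCoreVertex_rat_three_deep`) and `hord` (this file) — kernel theorems modulo [S24] only,
i.e. modulo what the route's rungs already carry.  References: [Sakamoto2024] Thm. 4.4 (1), §6;
[MazurRubin2004] Thm. 4.4.1, Cor. 4.1.9; [Rubin2011] Prop. 1.9.5, Def. 2.5.3.
-/

set_option autoImplicit false
-- the Theorems namespace of a single-conjunct summit repeats the summit name by design (D-0017)
set_option linter.dupNamespace false

noncomputable section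

open scoped Classical NumberField ContRepresentation
open Function Field NumberField IsDedekindDomain
open Literature.NumberTheory.GaloisRepresentations Literature.NumberTheory.GaloisRepresentations.DiscreteGaloisModule
  Literature.NumberTheory.GaloisCohomology
open Summit.BirchSwinnertonDyer.Rank1Residual.GaloisImage

universe u

namespace Summit.BirchSwinnertonDyer.BirchSwinnertonDyer.Theorems.KimAtThreeShallowEqDeepGoodCoreVertex

section Assembly

open WeierstrassCurve Literature.NumberTheory.EllipticCurves

variable (W : WeierstrassCurve ℚ) [W.IsElliptic] (j : ℕ)

/-- **`λ^*(d) = 0` for the induced residual structure of `𝓕_can^{(j+1)}(d)` on the DEEP class — no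
local hypothesis left.**  At a level `d` of a datum `D₂` on `E[3^{j+1}·3]` with primes in Sakamoto's
class of `τ` on `E[3^{j+1}·3]` and cyclotomic transverse conditions, if the dual Selmer group of the
residual Kummer structure `𝓚̄(d)` vanishes (files 1–2: `exists_superset_kummerSelmerGroup_eq_bot_…`),
then `lambdaStar inv ((D₂.atLevel 𝓕_can d).induced [3^{j+1}]) 3 = 0` — the hypothesis of the
bijectivity clause of [S24] Thm. 4.4 (1) at `d` (n1011 `SakamotoN11InstanceDeep`): file 5 §11 with
its `honto` DISCHARGED by `cyclotomicTransverse_le_map_torsionMulBy_of_mem_frobeniusClassPrimes`.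
[cite: Sakamoto2024, Thm. 4.4 (1) (p. 926), §6 (p. 930)] [cite: Rubin2011, Prop. 1.9.5 (1), Def. 2.5.3] -/
theorem lambdaStar_induced_atLevel_eq_zero_rat_three_deep [Finite (geomTorsion W ((3 : ℕ) : ℤ))]
    {Sset : Set (HeightOneSpectrum (𝓞 ℚ))} {τ : absoluteGaloisGroup ℚ}
    (hτμ : τ ∈ rootsOfUnityFixer ℚ (3 ^ (j + 1 + 1)))
    (hτ₂ : Nonempty (cokerSubOne (W.torsionGaloisModule (((3 : ℕ) : ℤ) ^ (j + 1) * ((3 : ℕ) : ℤ))) τ ≃+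
      ZMod (3 ^ (j + 1 + 1))))
    (hτ₃ : Nonempty (cokerSubOne (W.torsionGaloisModule (((3 : ℕ) : ℤ) ^ j * ((3 : ℕ) : ℤ))) τ ≃+
      ZMod (3 ^ (j + 1))))
    (hτ₁ : Nonempty (cokerSubOne (W.torsionGaloisModule ((3 : ℕ) : ℤ)) τ ≃+ ZMod 3))
    (inv : LocalInvariants ℚ 3)
    (D₁ : KolyvaginDatum (W.torsionGaloisModule ((3 : ℕ) : ℤ)))
    (D₂ : KolyvaginDatum (W.torsionGaloisModule (((3 : ℕ) : ℤ) ^ (j + 1) * ((3 : ℕ) : ℤ))))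
    (hP₂ : D₂.primes ⊆ frobeniusClassPrimes
      (W.torsionGaloisModule (((3 : ℕ) : ℤ) ^ (j + 1) * ((3 : ℕ) : ℤ))) Sset τ (3 ^ (j + 1 + 1)))
    (hT₁ : D₁.transverse = cyclotomicTransverse _) (hT₂ : D₂.transverse = cyclotomicTransverse _)
    {d : Finset (HeightOneSpectrum (𝓞 ℚ))} (hd : D₂.IsLevel d)
    (hbot : (inv.dualSelmerStructure (W.torsionGaloisModule ((3 : ℕ) : ℤ))
      (D₁.atLevel (W.kummerSelmerStructure ((3 : ℕ) : ℤ)) d)).selmerGroup = ⊥) :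
    LocalInvariants.lambdaStar inv ((D₂.atLevel (propagatedSelmerStructure W 3 (j + 1)) d).induced
      (W.torsionMulBy (((3 : ℕ) : ℤ) ^ (j + 1)) ((3 : ℕ) : ℤ))) 3 = 0 :=
  lambdaStar_induced_atLevel_eq_zero_of_transverse_onto W (j + 1) inv D₁ D₂ d
    (fun q hq => by
      rw [hT₁, hT₂]
      exact cyclotomicTransverse_le_map_torsionMulBy_of_mem_frobeniusClassPrimes W j hτμ hτ₂ hτ₃ hτ₁
        (hP₂ (hd hq)))
    hbot

/-- **`hord` on the deep class**: with [S24] Thm. 4.4 (1) at the depth `j + 2` on the datum `D₂` —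
`KS₁` free of rank one over `ℤ/3^{j+2}` (`hfree`) and the bijectivity clause at every level with
`λ^* = 0` (`hbij`; both = the conclusion of n1011's
`kolyvaginSystems_freeRankOne_propagatedSelmerStructure_deep`, i.e. the S24-DEEP port, or of the named
fact `Sakamoto2024.kolyvaginSystems_freeRankOne_zmod_three_pow` on a same-level class) — every
generator `g` of `KS₁` (`hgen`) has `addOrderOf (g d) = 3^{j+2}` at the good core vertex `d`: VERBATIM
the `hord` of `KimAtThreeDeepUpperEndCore.EndCore.exists_certificate_of_witnessAt` at depth index
`j + 1`.  With files 1–4 (`exists_goodCoreVertex_rat_three_deep`: `hinj`, size bound) this COMPLETES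
the GOOD CORE VERTEX port of cruxes 19076/19077 modulo [S24]. [cite: Sakamoto2024, Thm. 4.4 (1) (p. 926)]
[cite: MazurRubin2004, Thm. 4.4.1, Cor. 4.1.9] -/
theorem addOrderOf_apply_eq_rat_three_deep [Finite (geomTorsion W ((3 : ℕ) : ℤ))]
    {Sset : Set (HeightOneSpectrum (𝓞 ℚ))} {τ : absoluteGaloisGroup ℚ}
    (hτμ : τ ∈ rootsOfUnityFixer ℚ (3 ^ (j + 1 + 1)))
    (hτ₂ : Nonempty (cokerSubOne (W.torsionGaloisModule (((3 : ℕ) : ℤ) ^ (j + 1) * ((3 : ℕ) : ℤ))) τ ≃+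
      ZMod (3 ^ (j + 1 + 1))))
    (hτ₃ : Nonempty (cokerSubOne (W.torsionGaloisModule (((3 : ℕ) : ℤ) ^ j * ((3 : ℕ) : ℤ))) τ ≃+
      ZMod (3 ^ (j + 1))))
    (hτ₁ : Nonempty (cokerSubOne (W.torsionGaloisModule ((3 : ℕ) : ℤ)) τ ≃+ ZMod 3))
    (inv : LocalInvariants ℚ 3)
    (D₁ : KolyvaginDatum (W.torsionGaloisModule ((3 : ℕ) : ℤ)))
    (D₂ : KolyvaginDatum (W.torsionGaloisModule (((3 : ℕ) : ℤ) ^ (j + 1) * ((3 : ℕ) : ℤ))))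
    (hP₂ : D₂.primes ⊆ frobeniusClassPrimes
      (W.torsionGaloisModule (((3 : ℕ) : ℤ) ^ (j + 1) * ((3 : ℕ) : ℤ))) Sset τ (3 ^ (j + 1 + 1)))
    (hT₁ : D₁.transverse = cyclotomicTransverse _) (hT₂ : D₂.transverse = cyclotomicTransverse _)
    -- [S24] Thm. 4.4 (1) at depth `j + 2` on `D₂` (freeness + the bijectivity clause)
    (hfree : KolyvaginSystem.IsFreeRankOneZMod
      (D₂.kolyvaginSystems (propagatedSelmerStructure W 3 (j + 1))) (3 ^ (j + 1 + 1)))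
    (hbij : ∀ (d : Finset (HeightOneSpectrum (𝓞 ℚ))) (hd : D₂.IsLevel d),
      LocalInvariants.lambdaStar inv ((D₂.atLevel (propagatedSelmerStructure W 3 (j + 1)) d).induced
        (W.torsionMulBy (((3 : ℕ) : ℤ) ^ (j + 1)) ((3 : ℕ) : ℤ))) 3 = 0 →
      Function.Bijective fun κ : D₂.kolyvaginSystems (propagatedSelmerStructure W 3 (j + 1)) =>
        (⟨κ.1 d, ((KolyvaginDatum.mem_kolyvaginSystems_iff D₂ _ κ.1).mp κ.2).mem_selmerGroup d hd⟩ :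
          (D₂.atLevel (propagatedSelmerStructure W 3 (j + 1)) d).selmerGroup))
    -- the generator
    (g : Finset (HeightOneSpectrum (𝓞 ℚ)) →
      galoisCohomology (W.torsionGaloisModule (((3 : ℕ) : ℤ) ^ (j + 1) * ((3 : ℕ) : ℤ))) 1)
    (hg : g ∈ D₂.kolyvaginSystems (propagatedSelmerStructure W 3 (j + 1)))
    (hgen : ∀ κ ∈ D₂.kolyvaginSystems (propagatedSelmerStructure W 3 (j + 1)), ∃ a : ℕ, κ = a • g)
    -- the good core vertex
    {d : Finset (HeightOneSpectrum (𝓞 ℚ))} (hd : D₂.IsLevel d)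
    (hbot : (inv.dualSelmerStructure (W.torsionGaloisModule ((3 : ℕ) : ℤ))
      (D₁.atLevel (W.kummerSelmerStructure ((3 : ℕ) : ℤ)) d)).selmerGroup = ⊥) :
    addOrderOf (g d) = 3 ^ (j + 1 + 1) :=
  haveI : NeZero (3 ^ (j + 1 + 1)) := ⟨pow_ne_zero _ three_ne_zero⟩
  addOrderOf_apply_eq_of_bijective hfree g hg hgen hd
    (hbij d hd (lambdaStar_induced_atLevel_eq_zero_rat_three_deep W j hτμ hτ₂ hτ₃ hτ₁ inv D₁ D₂ hP₂ hT₁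
      hT₂ hd hbot))

end Assembly

end Summit.BirchSwinnertonDyer.BirchSwinnertonDyer.Theorems.KimAtThreeShallowEqDeepGoodCoreVertex

end
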